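import Summits.QuantumFields.YangMills.Theorems.BalabanUVNodesN22W1StripInduction

/-!
# BalabanUVNodes ∕ node N22 = NE9 — THE STRIP INDUCTION AT THE W1 OBJECT, MODULE 2: THE LETTERS — ROAD 3's (A) letter for the W1 functional
# straight from STRIP-(1.18) at every level (Schwarz symmetrisation), the MIXED producer (older couplings inherited + the last coupling's output
# letter of node N09's lane), generation 0's `youngHolo` slot DERIVED, and print's [I] p. 266 clause

Cell `pub-ymgap`, HUMAN RULING D-0062 (Track A), R134 ACCELERATION re-seat `pub-ymgap-dag-n22-c` (strategy s1), generation 2, module 2 of 2.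
THEOREMS ONLY; imports module 1 `…N22W1StripInduction` (the induction on the level: `stripBound_termC_of_stepOut`, `strip_succ_of_complexifiedTerms`,
`stepOut_of_propagation`, `stripBound_termC_of_propagation`; notation STRIP(j, i; E₀, κ) as there) and through it generation 0's
`…N22W1ActivityStrip` (p457296), the slot module (p452837: `YMDAG.N22.exists_holo_extension_of_re`) and the W1 OBJECT (p455641) BY NAME.
`--supports` the K3 item of route `BalabanUVNodes`.

WHAT.
* §1 `supLetter_functionalOn_of_stripBound` ∕ `supLetter_functional_of_stripBound` — STRIP at every level in every coupling (module 1's conclusion)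
  + backgrounds read inside the spaces ⟹ ROAD 3's (A) LETTER for `W1.functionalOn S p emb` ∕ `W1.functional S ι p` DIRECTLY at output level:
  every young-coupling section extends holomorphically to a set ⊇ the closed `r`-discs about `]0, γ]` with bound `E₀·1^{age}·e^{−κ d(X)}` — the
  `hA` clause of `YMDAG.N22.n22At_of_oscAnalytic` (`M := E₀`, `μ := 1`) and of n22-e's home slot `n22At_u3OfRecord₁₁_of_oscAnalytic` (p458073);
  Schwarz symmetrisation `exists_holo_extension_of_re` turns `Re E^{(j)}(X; g|g_i:=t; emb U)` into the section (`T4OutputRate.Functional` is real).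
* §2 `stepOut_of_propagationOlder_lastOut` — THE MIXED PRODUCER of module 1's one-step hypothesis: the term-level propagation hypothesis for the
  OLDER couplings `i < k` only (INHERITED through the old terms, [II] (2.15) p. 15) + a last-coupling output letter STRIP(k+1, k) (the [I] p. 266–267 ∕
  [H-dil] content, node N09 ∕ n22-d's `EHoloAt` lane — displayed); `supLetter_functionalOn_of_propagation` ∕ `…_of_propagationOlder_lastOut` ∕
  `supLetter_functional_of_propagation` — the (A) letter END TO END from either producer + the numerals.
* §3 `youngHolo_of_propagation` — generation 0's LEVEL-WISE activity slot `hYH` (p457296) is a THEOREM under `hprop` + numerals (its antecedent at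
  level `k` is module 1's conclusion at the levels `≤ k`); `analyticInEachCoupling266_functional_of_propagation` — print's [I] p. 266 clause
  («E^{(j)} … analytic functions of the effective coupling constants») for the functional of record, direction of record only.

HONEST FRAMING.  Count-neutral by-name knit AT THE OBJECT; NOT a discharge of N22; every producer hypothesis (`hprop`, `hpropOlder`, `hlast`, `hsp`)
is DISPLAYED and asserted nowhere (module 1's HONEST FRAMING applies verbatim; `hsp` = [I] p. 263 «the configurations … restricted to X belong to
U^c_j», Theorem-1 content).  NE9 NOT IN PRINT, NOT PROVED; one finite four-torus programme at fixed ε — NOT infinite volume, NOT OS on ℝ⁴, NOT a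
mass gap, NOT Clay.  0 `sorry`, 0 `def`, standard axioms.

References (TYPES only): [I] = [Balaban1987RG1] T. Bałaban, Commun. Math. Phys. **109** (1987) 249–301 — (1.18) p. 263, p. 266–267; [II] =
[Balaban1988RG2Cluster] T. Bałaban, Commun. Math. Phys. **116** (1988) 1–22 — (2.13)–(2.15) pp. 14–15, (2.38)–(2.41) pp. 20–21.
-/

noncomputable section

namespace YMDAG.N22.W1

open Set Metric
open scoped BigOperators
open Literature.MathematicalPhysics.QuantumFieldTheory.Balaban1983to89
open Literature.MathematicalPhysics.QuantumFieldTheory.Balaban1983to89.T4Continuum (T4Family)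
open Literature.MathematicalPhysics.QuantumFieldTheory.Balaban1983to89.T4OutputRate
open Literature.MathematicalPhysics.QuantumFieldTheory.Balaban1983to89.B13Resummation (locE)
open Literature.MathematicalPhysics.QuantumFieldTheory.Balaban1983to89.TreeLengthTorus (TPt TDom tsys torusTreeLen torusTreeLen_nonneg)
open Literature.MathematicalPhysics.QuantumFieldTheory.Balaban1983to89.TreeLengthTorusGeometry (TTouch)
open Literature.MathematicalPhysics.QuantumFieldTheory.Balaban1983to89.B12TreeDecay (K₀ K₀_pos)
open Literature.MathematicalPhysics.QuantumFieldTheory.Balaban1983to89.B12CouplingClausesHistory (AnalyticInEachCoupling266)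
open Literature.MathematicalPhysics.QuantumFieldTheory.Balaban1983to89.Node00
open Literature.MathematicalPhysics.QuantumFieldTheory.Balaban1983to89.Node00.Sect2 (domSys domCount CPair ofBackgroundC)
open Literature.MathematicalPhysics.QuantumFieldTheory.Balaban1983to89.Node00.W1
open Summit.QuantumFields.BalabanUV.T4Continuum.NE1p.DressedOutputAnalyticFaces (analytic_and_bounded_locE_param_torus)

variable (F : T4Family) (K : ℕ) {𝔸 : Type*} {M : ℕ}

/-! ## §1 ROAD 3's (A) letter for the W1 functional straight from STRIP at every level -/

/-- **STRIP AT EVERY LEVEL ⟹ ROAD 3's (A) LETTER FOR `W1.functionalOn S p emb`** (any frame `P`, any reading map `emb` with readings inside the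
spaces): at `X = ⟨j, Y⟩`, `i < j`, STRIP(j, i) at `(g, Y, emb U)` is a holomorphic `Ec` on an open `O ⊇` the closed `r`-discs about `]0, γ]` with
`‖Ec‖ ≤ E₀·e^{−κ d_j(Y)}` and `Ec t = E^{(j)}(Y; g|g_i:=t; emb U)`; the functional is its REAL PART at real `t` (`W1.functionalOn` = `(…).re` by `rfl`),
so Schwarz symmetrisation (`YMDAG.N22.exists_holo_extension_of_re`) gives the section's holomorphic extension with the same bound, written
`E₀·1^{age}·e^{−κ d(X)}` — the `hA` clause of `YMDAG.N22.n22At_of_oscAnalytic` with `M := E₀`, `μ := 1`. [folklore] -/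
theorem supLetter_functionalOn_of_stripBound {P : Params} (S : ClusterTower P 𝔸 M) (p : RunPairing) {B : Type} (emb : B → CPair P 𝔸)
    (sp : (j : ℕ) → (domSys P M j).Dom → Set (CPair P 𝔸)) (hsp : ∀ (j : ℕ) (U : B) (Y : (domSys P M j).Dom), emb U ∈ sp j Y)
    {γ r E₀ κ : ℝ}
    (hall : ∀ (j : ℕ) (g : ℕ → ℝ), g ∈ Window γ → ∀ (i : ℕ) (Y : (domSys P M j).Dom) (ψ : CPair P 𝔸), ψ ∈ sp j Y →
      ∃ (Ec : ℂ → ℂ) (O : Set ℂ), IsOpen O ∧ (∀ t ∈ Ioc (0 : ℝ) γ, closedBall (t : ℂ) r ⊆ O) ∧ DifferentiableOn ℂ Ec O ∧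
        (∀ z ∈ O, ‖Ec z‖ ≤ E₀ * Real.exp (-(κ * torusTreeLen Y.1))) ∧
        (∀ t ∈ Ioc (0 : ℝ) γ, Ec t = termC S j Y (Function.update g i t) ψ)) :
    ∀ g ∈ Window γ, ∀ (U : B) (X : (histCarriers P M p).Dom) (i : ℕ), i < (histCarriers P M p).scale X →
      ∃ (Fz : ℂ → ℂ) (Dset : Set ℂ), DifferentiableOn ℂ Fz Dset ∧
        (∀ z ∈ Dset, ‖Fz z‖ ≤ E₀ * 1 ^ ((histCarriers P M p).scale X - 1 - i) * Real.exp (-(κ * (histCarriers P M p).d X))) ∧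
        (∀ t ∈ Ioc (0 : ℝ) γ, closedBall (t : ℂ) r ⊆ Dset) ∧
        (∀ t ∈ Ioc (0 : ℝ) γ, Fz t = (functionalOn S p emb (Function.update g i t) U X : ℂ)) := by
  intro g hg U X i _
  obtain ⟨j, Y⟩ := X
  obtain ⟨Ec, O, hO, hdisc, hhol, hB, hrep⟩ := hall j g hg i Y (emb U) (hsp j U Y)
  refine exists_holo_extension_of_re (f := fun t => functionalOn S p emb (Function.update g i t) U ⟨j, Y⟩) hO hhol
    (fun z hz => ?_) hdisc (fun t ht => ?_)
  · rw [one_pow, mul_one]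
    exact hB z hz
  · rw [hrep t ht]
    rfl

/-- **STRIP AT EVERY LEVEL ⟹ ROAD 3's (A) LETTER FOR THE FUNCTIONAL OF RECORD `W1.functional S ι p`** (`emb := Sect2.ofBackgroundC ι`). [folklore] -/
theorem supLetter_functional_of_stripBound {P : Params} [Ring 𝔸] (S : ClusterTower P 𝔸 M) {G : Type} [Group G] (ι : G →* 𝔸ˣ)
    (p : RunPairing) (sp : (j : ℕ) → (domSys P M j).Dom → Set (CPair P 𝔸))
    (hsp : ∀ (j : ℕ) (U : GaugeField P 0 G) (Y : (domSys P M j).Dom), ofBackgroundC ι U ∈ sp j Y) {γ r E₀ κ : ℝ}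
    (hall : ∀ (j : ℕ) (g : ℕ → ℝ), g ∈ Window γ → ∀ (i : ℕ) (Y : (domSys P M j).Dom) (ψ : CPair P 𝔸), ψ ∈ sp j Y →
      ∃ (Ec : ℂ → ℂ) (O : Set ℂ), IsOpen O ∧ (∀ t ∈ Ioc (0 : ℝ) γ, closedBall (t : ℂ) r ⊆ O) ∧ DifferentiableOn ℂ Ec O ∧
        (∀ z ∈ O, ‖Ec z‖ ≤ E₀ * Real.exp (-(κ * torusTreeLen Y.1))) ∧
        (∀ t ∈ Ioc (0 : ℝ) γ, Ec t = termC S j Y (Function.update g i t) ψ)) :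
    ∀ g ∈ Window γ, ∀ (U : GaugeField P 0 G) (X : (histCarriers P M p).Dom) (i : ℕ), i < (histCarriers P M p).scale X →
      ∃ (Fz : ℂ → ℂ) (Dset : Set ℂ), DifferentiableOn ℂ Fz Dset ∧
        (∀ z ∈ Dset, ‖Fz z‖ ≤ E₀ * 1 ^ ((histCarriers P M p).scale X - 1 - i) * Real.exp (-(κ * (histCarriers P M p).d X))) ∧
        (∀ t ∈ Ioc (0 : ℝ) γ, closedBall (t : ℂ) r ⊆ Dset) ∧
        (∀ t ∈ Ioc (0 : ℝ) γ, Fz t = (functional S ι p (Function.update g i t) U X : ℂ)) :=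
  supLetter_functionalOn_of_stripBound S p (ofBackgroundC ι) sp hsp hall

/-! ## §2 The mixed producer, and the (A) letter end to end from either producer -/

/-- **THE MIXED PRODUCER: `hprop` FOR THE OLDER COUPLINGS + A LAST-COUPLING OUTPUT LETTER.**  The older couplings `i < k` are INHERITED through the
old terms ([II] (2.15) p. 15) — `hprop` as in `stepOut_of_propagation` but asked only for `i < k`; the LAST coupling `g_k` of step `k` enters the
Gaussian integrals and characteristic functions of (2.14) themselves, and its strip letter STRIP(k+1, k) is the [I] p. 266–267 ∕ [H-dil] content
delivered at OUTPUT level by node N09 (n22-d's `EHoloAt` lane) — `hlast`, displayed.  Together they give §1's one-step hypothesis. [folklore] -/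
theorem stepOut_of_propagationOlder_lastOut (S : ClusterTower (F.P K) 𝔸 M)
    (sp : (j : ℕ) → (domSys (F.P K) M j).Dom → Set (CPair (F.P K) 𝔸))
    {γ r E₀ κ A R r₁ : ℝ} (hA0 : 0 ≤ A) (hr₁ : 0 ≤ r₁) (hκ : κ ≤ r₁) (hrate : r₁ + 2 * (64 * Real.log 162) + 2 ≤ R)
    (hsmall : A * Real.exp (5 * r₁ + 1) * K₀ 64 8 * 9 * 64 ≤ 1) (hrenew : Real.exp 1 * 9 * 64 * K₀ 64 8 ^ 2 * A ≤ E₀)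
    (hpropOlder : ∀ (k : ℕ) (g : ℕ → ℝ), g ∈ Window γ → ∀ (i : ℕ), i < k → ∀ (X : (domSys (F.P K) M (k + 1)).Dom) (φ : CPair (F.P K) 𝔸),
      φ ∈ sp (k + 1) X →
      (∀ (j : ℕ), j < k + 1 → ∀ (Y : (domSys (F.P K) M j).Dom) (ψ : CPair (F.P K) 𝔸), ψ ∈ sp j Y →
        ∃ (Ec : ℂ → ℂ) (O : Set ℂ), IsOpen O ∧ (∀ t ∈ Ioc (0 : ℝ) γ, closedBall (t : ℂ) r ⊆ O) ∧ DifferentiableOn ℂ Ec O ∧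
          (∀ z ∈ O, ‖Ec z‖ ≤ E₀ * Real.exp (-(κ * torusTreeLen Y.1))) ∧
          (∀ t ∈ Ioc (0 : ℝ) γ, Ec t = termC S j Y (Function.update g i t) ψ)) →
      ∃ (Tc : (S k).Idx → ℂ → ℂ) (O : Set ℂ), IsOpen O ∧ (∀ t ∈ Ioc (0 : ℝ) γ, closedBall (t : ℂ) r ⊆ O) ∧
        (∀ Z : (domSys (F.P K) M (k + 1)).Dom, Z.1 ⊆ X.1 → ∀ j ∈ (S k).idx Z, DifferentiableOn ℂ (Tc j) O) ∧
        (∀ z ∈ O, ∀ Z : (domSys (F.P K) M (k + 1)).Dom, Z.1 ⊆ X.1 →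
          ∑ j ∈ (S k).idx Z, ‖Tc j z‖ ≤ A * Real.exp (-(R * torusTreeLen Z.1))) ∧
        (∀ t ∈ Ioc (0 : ℝ) γ, ∀ j, Tc j t = (S k).T j (restrictPrefix k (Function.update g i t)) φ))
    (hlast : ∀ (k : ℕ) (g : ℕ → ℝ), g ∈ Window γ → ∀ (X : (domSys (F.P K) M (k + 1)).Dom) (φ : CPair (F.P K) 𝔸), φ ∈ sp (k + 1) X →
      (∀ (j : ℕ), j < k + 1 → ∀ (Y : (domSys (F.P K) M j).Dom) (ψ : CPair (F.P K) 𝔸), ψ ∈ sp j Y →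
        ∃ (Ec : ℂ → ℂ) (O : Set ℂ), IsOpen O ∧ (∀ t ∈ Ioc (0 : ℝ) γ, closedBall (t : ℂ) r ⊆ O) ∧ DifferentiableOn ℂ Ec O ∧
          (∀ z ∈ O, ‖Ec z‖ ≤ E₀ * Real.exp (-(κ * torusTreeLen Y.1))) ∧
          (∀ t ∈ Ioc (0 : ℝ) γ, Ec t = termC S j Y (Function.update g k t) ψ)) →
      ∃ (Ec : ℂ → ℂ) (O : Set ℂ), IsOpen O ∧ (∀ t ∈ Ioc (0 : ℝ) γ, closedBall (t : ℂ) r ⊆ O) ∧ DifferentiableOn ℂ Ec O ∧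
        (∀ z ∈ O, ‖Ec z‖ ≤ E₀ * Real.exp (-(κ * torusTreeLen X.1))) ∧
        (∀ t ∈ Ioc (0 : ℝ) γ, Ec t = termC S (k + 1) X (Function.update g k t) φ)) :
    ∀ (k : ℕ) (g : ℕ → ℝ), g ∈ Window γ → ∀ (i : ℕ), i < k + 1 → ∀ (X : (domSys (F.P K) M (k + 1)).Dom) (φ : CPair (F.P K) 𝔸),
      φ ∈ sp (k + 1) X →
      (∀ (j : ℕ), j < k + 1 → ∀ (Y : (domSys (F.P K) M j).Dom) (ψ : CPair (F.P K) 𝔸), ψ ∈ sp j Y →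
        ∃ (Ec : ℂ → ℂ) (O : Set ℂ), IsOpen O ∧ (∀ t ∈ Ioc (0 : ℝ) γ, closedBall (t : ℂ) r ⊆ O) ∧ DifferentiableOn ℂ Ec O ∧
          (∀ z ∈ O, ‖Ec z‖ ≤ E₀ * Real.exp (-(κ * torusTreeLen Y.1))) ∧
          (∀ t ∈ Ioc (0 : ℝ) γ, Ec t = termC S j Y (Function.update g i t) ψ)) →
      ∃ (Ec : ℂ → ℂ) (O : Set ℂ), IsOpen O ∧ (∀ t ∈ Ioc (0 : ℝ) γ, closedBall (t : ℂ) r ⊆ O) ∧ DifferentiableOn ℂ Ec O ∧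
        (∀ z ∈ O, ‖Ec z‖ ≤ E₀ * Real.exp (-(κ * torusTreeLen X.1))) ∧
        (∀ t ∈ Ioc (0 : ℝ) γ, Ec t = termC S (k + 1) X (Function.update g i t) φ) := by
  intro k g hg i hi X φ hφ hIH
  rcases Nat.lt_succ_iff_lt_or_eq.mp hi with hik | rfl
  · -- an older coupling: the term-level step at this `(k, g, i, X, φ)`
    obtain ⟨Tc, O, hO, hdisc, hhol, hmaj, hrepT⟩ := hpropOlder k g hg i hik X φ hφ hIH
    exact strip_succ_of_complexifiedTerms F K S hA0 hr₁ hκ hrate hsmall hrenew k g i X φ Tc O hO hdisc hhol hmaj hrepT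
  · -- the last coupling: the output-level letter
    exact hlast i g hg X φ hφ hIH

/-- **ROAD 3's (A) LETTER FOR THE W1 FUNCTIONAL FROM THE PROPAGATION HYPOTHESIS, END TO END**: `hprop` (module 1) + the numerals + readings
inside the spaces ⟹ the `hA` clause with `M := E₀`, `μ := 1` (§1 on module 1's `stripBound_termC_of_propagation`). [folklore] -/
theorem supLetter_functionalOn_of_propagation (S : ClusterTower (F.P K) 𝔸 M) (p : RunPairing) {B : Type} (emb : B → CPair (F.P K) 𝔸)
    (sp : (j : ℕ) → (domSys (F.P K) M j).Dom → Set (CPair (F.P K) 𝔸)) (hsp : ∀ (j : ℕ) (U : B) (Y : (domSys (F.P K) M j).Dom), emb U ∈ sp j Y)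
    {γ r E₀ κ A R r₁ : ℝ} (hr : 0 ≤ r) (hA0 : 0 ≤ A) (hr₁ : 0 ≤ r₁) (hκ : κ ≤ r₁) (hrate : r₁ + 2 * (64 * Real.log 162) + 2 ≤ R)
    (hsmall : A * Real.exp (5 * r₁ + 1) * K₀ 64 8 * 9 * 64 ≤ 1) (hrenew : Real.exp 1 * 9 * 64 * K₀ 64 8 ^ 2 * A ≤ E₀)
    (hprop : ∀ (k : ℕ) (g : ℕ → ℝ), g ∈ Window γ → ∀ (i : ℕ), i < k + 1 → ∀ (X : (domSys (F.P K) M (k + 1)).Dom) (φ : CPair (F.P K) 𝔸),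
      φ ∈ sp (k + 1) X →
      (∀ (j : ℕ), j < k + 1 → ∀ (Y : (domSys (F.P K) M j).Dom) (ψ : CPair (F.P K) 𝔸), ψ ∈ sp j Y →
        ∃ (Ec : ℂ → ℂ) (O : Set ℂ), IsOpen O ∧ (∀ t ∈ Ioc (0 : ℝ) γ, closedBall (t : ℂ) r ⊆ O) ∧ DifferentiableOn ℂ Ec O ∧
          (∀ z ∈ O, ‖Ec z‖ ≤ E₀ * Real.exp (-(κ * torusTreeLen Y.1))) ∧
          (∀ t ∈ Ioc (0 : ℝ) γ, Ec t = termC S j Y (Function.update g i t) ψ)) →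
      ∃ (Tc : (S k).Idx → ℂ → ℂ) (O : Set ℂ), IsOpen O ∧ (∀ t ∈ Ioc (0 : ℝ) γ, closedBall (t : ℂ) r ⊆ O) ∧
        (∀ Z : (domSys (F.P K) M (k + 1)).Dom, Z.1 ⊆ X.1 → ∀ j ∈ (S k).idx Z, DifferentiableOn ℂ (Tc j) O) ∧
        (∀ z ∈ O, ∀ Z : (domSys (F.P K) M (k + 1)).Dom, Z.1 ⊆ X.1 →
          ∑ j ∈ (S k).idx Z, ‖Tc j z‖ ≤ A * Real.exp (-(R * torusTreeLen Z.1))) ∧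
        (∀ t ∈ Ioc (0 : ℝ) γ, ∀ j, Tc j t = (S k).T j (restrictPrefix k (Function.update g i t)) φ)) :
    ∀ g ∈ Window γ, ∀ (U : B) (X : (histCarriers (F.P K) M p).Dom) (i : ℕ), i < (histCarriers (F.P K) M p).scale X →
      ∃ (Fz : ℂ → ℂ) (Dset : Set ℂ), DifferentiableOn ℂ Fz Dset ∧
        (∀ z ∈ Dset, ‖Fz z‖ ≤ E₀ * 1 ^ ((histCarriers (F.P K) M p).scale X - 1 - i) * Real.exp (-(κ * (histCarriers (F.P K) M p).d X))) ∧
        (∀ t ∈ Ioc (0 : ℝ) γ, closedBall (t : ℂ) r ⊆ Dset) ∧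
        (∀ t ∈ Ioc (0 : ℝ) γ, Fz t = (functionalOn S p emb (Function.update g i t) U X : ℂ)) :=
  supLetter_functionalOn_of_stripBound S p emb sp hsp (stripBound_termC_of_propagation F K S sp hr hA0 hr₁ hκ hrate hsmall hrenew hprop)

/-- **THE SAME FOR THE FUNCTIONAL OF RECORD `W1.functional S ι p`** (`emb := Sect2.ofBackgroundC ι`). [folklore] -/
theorem supLetter_functional_of_propagation [Ring 𝔸] (S : ClusterTower (F.P K) 𝔸 M) {G : Type} [Group G] (ι : G →* 𝔸ˣ) (p : RunPairing)
    (sp : (j : ℕ) → (domSys (F.P K) M j).Dom → Set (CPair (F.P K) 𝔸))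
    (hsp : ∀ (j : ℕ) (U : GaugeField (F.P K) 0 G) (Y : (domSys (F.P K) M j).Dom), ofBackgroundC ι U ∈ sp j Y)
    {γ r E₀ κ A R r₁ : ℝ} (hr : 0 ≤ r) (hA0 : 0 ≤ A) (hr₁ : 0 ≤ r₁) (hκ : κ ≤ r₁) (hrate : r₁ + 2 * (64 * Real.log 162) + 2 ≤ R)
    (hsmall : A * Real.exp (5 * r₁ + 1) * K₀ 64 8 * 9 * 64 ≤ 1) (hrenew : Real.exp 1 * 9 * 64 * K₀ 64 8 ^ 2 * A ≤ E₀)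
    (hprop : ∀ (k : ℕ) (g : ℕ → ℝ), g ∈ Window γ → ∀ (i : ℕ), i < k + 1 → ∀ (X : (domSys (F.P K) M (k + 1)).Dom) (φ : CPair (F.P K) 𝔸),
      φ ∈ sp (k + 1) X →
      (∀ (j : ℕ), j < k + 1 → ∀ (Y : (domSys (F.P K) M j).Dom) (ψ : CPair (F.P K) 𝔸), ψ ∈ sp j Y →
        ∃ (Ec : ℂ → ℂ) (O : Set ℂ), IsOpen O ∧ (∀ t ∈ Ioc (0 : ℝ) γ, closedBall (t : ℂ) r ⊆ O) ∧ DifferentiableOn ℂ Ec O ∧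
          (∀ z ∈ O, ‖Ec z‖ ≤ E₀ * Real.exp (-(κ * torusTreeLen Y.1))) ∧
          (∀ t ∈ Ioc (0 : ℝ) γ, Ec t = termC S j Y (Function.update g i t) ψ)) →
      ∃ (Tc : (S k).Idx → ℂ → ℂ) (O : Set ℂ), IsOpen O ∧ (∀ t ∈ Ioc (0 : ℝ) γ, closedBall (t : ℂ) r ⊆ O) ∧
        (∀ Z : (domSys (F.P K) M (k + 1)).Dom, Z.1 ⊆ X.1 → ∀ j ∈ (S k).idx Z, DifferentiableOn ℂ (Tc j) O) ∧
        (∀ z ∈ O, ∀ Z : (domSys (F.P K) M (k + 1)).Dom, Z.1 ⊆ X.1 →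
          ∑ j ∈ (S k).idx Z, ‖Tc j z‖ ≤ A * Real.exp (-(R * torusTreeLen Z.1))) ∧
        (∀ t ∈ Ioc (0 : ℝ) γ, ∀ j, Tc j t = (S k).T j (restrictPrefix k (Function.update g i t)) φ)) :
    ∀ g ∈ Window γ, ∀ (U : GaugeField (F.P K) 0 G) (X : (histCarriers (F.P K) M p).Dom) (i : ℕ), i < (histCarriers (F.P K) M p).scale X →
      ∃ (Fz : ℂ → ℂ) (Dset : Set ℂ), DifferentiableOn ℂ Fz Dset ∧
        (∀ z ∈ Dset, ‖Fz z‖ ≤ E₀ * 1 ^ ((histCarriers (F.P K) M p).scale X - 1 - i) * Real.exp (-(κ * (histCarriers (F.P K) M p).d X))) ∧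
        (∀ t ∈ Ioc (0 : ℝ) γ, closedBall (t : ℂ) r ⊆ Dset) ∧
        (∀ t ∈ Ioc (0 : ℝ) γ, Fz t = (functional S ι p (Function.update g i t) U X : ℂ)) :=
  supLetter_functionalOn_of_propagation F K S p (ofBackgroundC ι) sp hsp hr hA0 hr₁ hκ hrate hsmall hrenew hprop

/-- **ROAD 3's (A) LETTER FROM THE MIXED PRODUCER, END TO END**: `hpropOlder` + `hlast` + the numerals + readings inside the spaces ⟹ the
`hA` clause with `M := E₀`, `μ := 1` (§1 on module 1's `stripBound_termC_of_stepOut` fed by `stepOut_of_propagationOlder_lastOut`). [folklore] -/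
theorem supLetter_functionalOn_of_propagationOlder_lastOut (S : ClusterTower (F.P K) 𝔸 M) (p : RunPairing) {B : Type}
    (emb : B → CPair (F.P K) 𝔸) (sp : (j : ℕ) → (domSys (F.P K) M j).Dom → Set (CPair (F.P K) 𝔸))
    (hsp : ∀ (j : ℕ) (U : B) (Y : (domSys (F.P K) M j).Dom), emb U ∈ sp j Y)
    {γ r E₀ κ A R r₁ : ℝ} (hr : 0 ≤ r) (hA0 : 0 ≤ A) (hr₁ : 0 ≤ r₁) (hκ : κ ≤ r₁) (hrate : r₁ + 2 * (64 * Real.log 162) + 2 ≤ R)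
    (hsmall : A * Real.exp (5 * r₁ + 1) * K₀ 64 8 * 9 * 64 ≤ 1) (hrenew : Real.exp 1 * 9 * 64 * K₀ 64 8 ^ 2 * A ≤ E₀)
    (hpropOlder : ∀ (k : ℕ) (g : ℕ → ℝ), g ∈ Window γ → ∀ (i : ℕ), i < k → ∀ (X : (domSys (F.P K) M (k + 1)).Dom) (φ : CPair (F.P K) 𝔸),
      φ ∈ sp (k + 1) X →
      (∀ (j : ℕ), j < k + 1 → ∀ (Y : (domSys (F.P K) M j).Dom) (ψ : CPair (F.P K) 𝔸), ψ ∈ sp j Y →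
        ∃ (Ec : ℂ → ℂ) (O : Set ℂ), IsOpen O ∧ (∀ t ∈ Ioc (0 : ℝ) γ, closedBall (t : ℂ) r ⊆ O) ∧ DifferentiableOn ℂ Ec O ∧
          (∀ z ∈ O, ‖Ec z‖ ≤ E₀ * Real.exp (-(κ * torusTreeLen Y.1))) ∧
          (∀ t ∈ Ioc (0 : ℝ) γ, Ec t = termC S j Y (Function.update g i t) ψ)) →
      ∃ (Tc : (S k).Idx → ℂ → ℂ) (O : Set ℂ), IsOpen O ∧ (∀ t ∈ Ioc (0 : ℝ) γ, closedBall (t : ℂ) r ⊆ O) ∧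
        (∀ Z : (domSys (F.P K) M (k + 1)).Dom, Z.1 ⊆ X.1 → ∀ j ∈ (S k).idx Z, DifferentiableOn ℂ (Tc j) O) ∧
        (∀ z ∈ O, ∀ Z : (domSys (F.P K) M (k + 1)).Dom, Z.1 ⊆ X.1 →
          ∑ j ∈ (S k).idx Z, ‖Tc j z‖ ≤ A * Real.exp (-(R * torusTreeLen Z.1))) ∧
        (∀ t ∈ Ioc (0 : ℝ) γ, ∀ j, Tc j t = (S k).T j (restrictPrefix k (Function.update g i t)) φ))
    (hlast : ∀ (k : ℕ) (g : ℕ → ℝ), g ∈ Window γ → ∀ (X : (domSys (F.P K) M (k + 1)).Dom) (φ : CPair (F.P K) 𝔸), φ ∈ sp (k + 1) X →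
      (∀ (j : ℕ), j < k + 1 → ∀ (Y : (domSys (F.P K) M j).Dom) (ψ : CPair (F.P K) 𝔸), ψ ∈ sp j Y →
        ∃ (Ec : ℂ → ℂ) (O : Set ℂ), IsOpen O ∧ (∀ t ∈ Ioc (0 : ℝ) γ, closedBall (t : ℂ) r ⊆ O) ∧ DifferentiableOn ℂ Ec O ∧
          (∀ z ∈ O, ‖Ec z‖ ≤ E₀ * Real.exp (-(κ * torusTreeLen Y.1))) ∧
          (∀ t ∈ Ioc (0 : ℝ) γ, Ec t = termC S j Y (Function.update g k t) ψ)) →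
      ∃ (Ec : ℂ → ℂ) (O : Set ℂ), IsOpen O ∧ (∀ t ∈ Ioc (0 : ℝ) γ, closedBall (t : ℂ) r ⊆ O) ∧ DifferentiableOn ℂ Ec O ∧
        (∀ z ∈ O, ‖Ec z‖ ≤ E₀ * Real.exp (-(κ * torusTreeLen X.1))) ∧
        (∀ t ∈ Ioc (0 : ℝ) γ, Ec t = termC S (k + 1) X (Function.update g k t) φ)) :
    ∀ g ∈ Window γ, ∀ (U : B) (X : (histCarriers (F.P K) M p).Dom) (i : ℕ), i < (histCarriers (F.P K) M p).scale X →
      ∃ (Fz : ℂ → ℂ) (Dset : Set ℂ), DifferentiableOn ℂ Fz Dset ∧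
        (∀ z ∈ Dset, ‖Fz z‖ ≤ E₀ * 1 ^ ((histCarriers (F.P K) M p).scale X - 1 - i) * Real.exp (-(κ * (histCarriers (F.P K) M p).d X))) ∧
        (∀ t ∈ Ioc (0 : ℝ) γ, closedBall (t : ℂ) r ⊆ Dset) ∧
        (∀ t ∈ Ioc (0 : ℝ) γ, Fz t = (functionalOn S p emb (Function.update g i t) U X : ℂ)) :=
  have hM : 0 ≤ Real.exp 1 * 9 * 64 * K₀ 64 8 ^ 2 * A := by positivity
  supLetter_functionalOn_of_stripBound S p emb sp hsp (stripBound_termC_of_stepOut S sp hr (le_trans hM hrenew)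
    (stepOut_of_propagationOlder_lastOut F K S sp hA0 hr₁ hκ hrate hsmall hrenew hpropOlder hlast))

/-! ## §3 Generation 0's level-wise slot derived, and print's p. 266 clause -/

/-- **GENERATION 0's LEVEL-WISE SLOT `hYH`, DERIVED** (p457296 `hAct_functionalOn_of_youngHolo` ∕ `supLetter_functionalOn_of_youngHolo`'s hypothesis):
the term-level propagation hypothesis + the numerals give, at every step `k`, for backgrounds read inside the spaces, the young-coupling
strip-holomorphic activity family under the one majorant `A·e^{−R d}` with `Hc t = (S k).Hh (g | g_i := t) (emb U)` — the antecedent of `hprop` at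
level `k` being the conclusion of the induction `stripBound_termC_of_propagation` at the levels `≤ k` (finite sums of holomorphic functions,
`‖Σ‖ ≤ Σ‖·‖`). [folklore] -/
theorem youngHolo_of_propagation (S : ClusterTower (F.P K) 𝔸 M) {B : Type} (emb : B → CPair (F.P K) 𝔸)
    (sp : (j : ℕ) → (domSys (F.P K) M j).Dom → Set (CPair (F.P K) 𝔸)) (hsp : ∀ (j : ℕ) (U : B) (Y : (domSys (F.P K) M j).Dom), emb U ∈ sp j Y)
    {γ r E₀ κ A R r₁ : ℝ} (hr : 0 ≤ r) (hA0 : 0 ≤ A) (hr₁ : 0 ≤ r₁) (hκ : κ ≤ r₁) (hrate : r₁ + 2 * (64 * Real.log 162) + 2 ≤ R)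
    (hsmall : A * Real.exp (5 * r₁ + 1) * K₀ 64 8 * 9 * 64 ≤ 1) (hrenew : Real.exp 1 * 9 * 64 * K₀ 64 8 ^ 2 * A ≤ E₀)
    (hprop : ∀ (k : ℕ) (g : ℕ → ℝ), g ∈ Window γ → ∀ (i : ℕ), i < k + 1 → ∀ (X : (domSys (F.P K) M (k + 1)).Dom) (φ : CPair (F.P K) 𝔸),
      φ ∈ sp (k + 1) X →
      (∀ (j : ℕ), j < k + 1 → ∀ (Y : (domSys (F.P K) M j).Dom) (ψ : CPair (F.P K) 𝔸), ψ ∈ sp j Y →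
        ∃ (Ec : ℂ → ℂ) (O : Set ℂ), IsOpen O ∧ (∀ t ∈ Ioc (0 : ℝ) γ, closedBall (t : ℂ) r ⊆ O) ∧ DifferentiableOn ℂ Ec O ∧
          (∀ z ∈ O, ‖Ec z‖ ≤ E₀ * Real.exp (-(κ * torusTreeLen Y.1))) ∧
          (∀ t ∈ Ioc (0 : ℝ) γ, Ec t = termC S j Y (Function.update g i t) ψ)) →
      ∃ (Tc : (S k).Idx → ℂ → ℂ) (O : Set ℂ), IsOpen O ∧ (∀ t ∈ Ioc (0 : ℝ) γ, closedBall (t : ℂ) r ⊆ O) ∧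
        (∀ Z : (domSys (F.P K) M (k + 1)).Dom, Z.1 ⊆ X.1 → ∀ j ∈ (S k).idx Z, DifferentiableOn ℂ (Tc j) O) ∧
        (∀ z ∈ O, ∀ Z : (domSys (F.P K) M (k + 1)).Dom, Z.1 ⊆ X.1 →
          ∑ j ∈ (S k).idx Z, ‖Tc j z‖ ≤ A * Real.exp (-(R * torusTreeLen Z.1))) ∧
        (∀ t ∈ Ioc (0 : ℝ) γ, ∀ j, Tc j t = (S k).T j (restrictPrefix k (Function.update g i t)) φ)) :
    ∀ (k : ℕ) (g : ℕ → ℝ), g ∈ Window γ → ∀ (U : B) (X : (domSys (F.P K) M (k + 1)).Dom) (i : ℕ), i < k + 1 →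
      ∃ (Hc : ℂ → (domSys (F.P K) M (k + 1)).Dom → ℂ) (O : Set ℂ), IsOpen O ∧ (∀ t ∈ Ioc (0 : ℝ) γ, closedBall (t : ℂ) r ⊆ O) ∧
        (∀ Z : (domSys (F.P K) M (k + 1)).Dom, Z.1 ⊆ X.1 → DifferentiableOn ℂ (fun z => Hc z Z) O) ∧
        (∀ z ∈ O, ∀ Z : (domSys (F.P K) M (k + 1)).Dom, Z.1 ⊆ X.1 → ‖Hc z Z‖ ≤ A * Real.exp (-(R * torusTreeLen Z.1))) ∧
        (∀ t ∈ Ioc (0 : ℝ) γ, Hc t = (S k).Hh (Function.update g i t) (emb U)) := by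
  have hall := stripBound_termC_of_propagation F K S sp hr hA0 hr₁ hκ hrate hsmall hrenew hprop
  intro k g hg U X i hi
  obtain ⟨Tc, O, hO, hdisc, hhol, hmaj, hrepT⟩ :=
    hprop k g hg i hi X (emb U) (hsp (k + 1) U X) fun j _ Y ψ hψ => hall j g hg i Y ψ hψ
  refine ⟨fun z Z => ∑ j ∈ (S k).idx Z, Tc j z, O, hO, hdisc, fun Z hZ => ?_, fun z hz Z hZ => ?_, fun t ht => ?_⟩
  · exact DifferentiableOn.fun_sum fun j hj => hhol Z hZ j hj
  · exact (norm_sum_le _ _).trans (hmaj z hz Z hZ)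
  · funext Z
    simp only [ClusterStep.Hh, ClusterStep.H]
    exact Finset.sum_congr rfl fun j _ => hrepT t ht j

open Classical in
/-- **THE PRINTED [I] p. 266 CLAUSE FOR THE FUNCTIONAL OF RECORD FROM THE PROPAGATION HYPOTHESIS** (direction of record only; `r > 0`):
`AnalyticInEachCoupling266 (Window γ) (Ioc 0 γ) scale (fun _ => univ) (W1.functional S ι p)` — generation 0's
`analyticInEachCoupling266_functional_of_youngHolo` BY NAME on `youngHolo_of_propagation`.  The converse is NE9's unprinted content and is NOT claimed.
[cite: Balaban1987RG1, §2 p.266 (sentence after (2.9))] -/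
theorem analyticInEachCoupling266_functional_of_propagation [Ring 𝔸] (S : ClusterTower (F.P K) 𝔸 M) {G : Type} [Group G] (ι : G →* 𝔸ˣ)
    (p : RunPairing) (sp : (j : ℕ) → (domSys (F.P K) M j).Dom → Set (CPair (F.P K) 𝔸))
    (hsp : ∀ (j : ℕ) (U : GaugeField (F.P K) 0 G) (Y : (domSys (F.P K) M j).Dom), ofBackgroundC ι U ∈ sp j Y)
    {γ r E₀ κ A R r₁ : ℝ} (hr : 0 < r) (hA0 : 0 ≤ A) (hr₁ : 0 ≤ r₁) (hκ : κ ≤ r₁) (hrate : r₁ + 2 * (64 * Real.log 162) + 2 ≤ R)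
    (hsmall : A * Real.exp (5 * r₁ + 1) * K₀ 64 8 * 9 * 64 ≤ 1) (hrenew : Real.exp 1 * 9 * 64 * K₀ 64 8 ^ 2 * A ≤ E₀)
    (hprop : ∀ (k : ℕ) (g : ℕ → ℝ), g ∈ Window γ → ∀ (i : ℕ), i < k + 1 → ∀ (X : (domSys (F.P K) M (k + 1)).Dom) (φ : CPair (F.P K) 𝔸),
      φ ∈ sp (k + 1) X →
      (∀ (j : ℕ), j < k + 1 → ∀ (Y : (domSys (F.P K) M j).Dom) (ψ : CPair (F.P K) 𝔸), ψ ∈ sp j Y →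
        ∃ (Ec : ℂ → ℂ) (O : Set ℂ), IsOpen O ∧ (∀ t ∈ Ioc (0 : ℝ) γ, closedBall (t : ℂ) r ⊆ O) ∧ DifferentiableOn ℂ Ec O ∧
          (∀ z ∈ O, ‖Ec z‖ ≤ E₀ * Real.exp (-(κ * torusTreeLen Y.1))) ∧
          (∀ t ∈ Ioc (0 : ℝ) γ, Ec t = termC S j Y (Function.update g i t) ψ)) →
      ∃ (Tc : (S k).Idx → ℂ → ℂ) (O : Set ℂ), IsOpen O ∧ (∀ t ∈ Ioc (0 : ℝ) γ, closedBall (t : ℂ) r ⊆ O) ∧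
        (∀ Z : (domSys (F.P K) M (k + 1)).Dom, Z.1 ⊆ X.1 → ∀ j ∈ (S k).idx Z, DifferentiableOn ℂ (Tc j) O) ∧
        (∀ z ∈ O, ∀ Z : (domSys (F.P K) M (k + 1)).Dom, Z.1 ⊆ X.1 →
          ∑ j ∈ (S k).idx Z, ‖Tc j z‖ ≤ A * Real.exp (-(R * torusTreeLen Z.1))) ∧
        (∀ t ∈ Ioc (0 : ℝ) γ, ∀ j, Tc j t = (S k).T j (restrictPrefix k (Function.update g i t)) φ)) :
    AnalyticInEachCoupling266 (Window γ) (Ioc 0 γ) (histCarriers (F.P K) M p).scale (fun _ => (Set.univ : Set (GaugeField (F.P K) 0 G)))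
      (functional S ι p) :=
  analyticInEachCoupling266_functional_of_youngHolo F K S ι p hA0 hr₁ hκ hrate hsmall hr
    (youngHolo_of_propagation F K S (ofBackgroundC ι) sp hsp hr.le hA0 hr₁ hκ hrate hsmall hrenew hprop)

end YMDAG.N22.W1

end
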